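import Summits.CriticalPhenomena.PercolationContinuityZ3.Theorems.PercNearOneGluingNoHeavyQuantIndepBlobMoments
import Summits.CriticalPhenomena.PercolationContinuityZ3.Theorems.PercNearOneGluingNoHeavyLowerTailAntipodalHarris
import HarnessLib

/-!
# QUANT lane R8, FAR for independent blobs (II): the half-mean small-ball inequality
# `P(X < EX/2) ≤ max_i P(gate i closed)` for weighted sums of independent Bernoulli gates

builds on p205010 (kernel theorem, internal audit signed; external expert review pending)

Support file (`--supports stmt-CriticalPhenomena-4575`), QUANT lane lead (gen 5), rung R8 of
`run/shared/lean/prim/quant/LADDER.md`; memo `run/shared/lean/prim/quant/prim-quant-lead-g5/LEAD-NOTES-G5.md` N12.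

**Theorem (half-mean small-ball inequality; FAR for independent blobs).**  Let `ε₀, (ε_i)_{i∈ι}` be independent Bernoulli
gates with `P(ε₀ = 1) = p₀ ≤ p_i = P(ε_i = 1) ≤ 1`, weights `a₀, a_i ≥ 0`, `X = a₀ ε₀ + ∑ a_i ε_i`, `m = EX = a₀p₀ + ∑ a_i p_i`.
Then `P(X < m/2) ≤ 1 − p₀ = max P(gate closed)`; equivalently `P(X ≥ EX/2) ≥ min gate`, and for every `j` with `2j < EX`,
`P(X ≤ j) ≤ max_i P(ε_i = 0)` (`far_indepBlob`).  For the block-star graph (observer `o` joined by an edge of weight `p_i` to a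
weight-1-glued blob of `a_i` relays, blobs disjoint; `o ∈ A` is a blob with gate 1) this is EXACTLY the far-relay row
`Quant.FarRelayRow` (`…QuantFarRelayRow.lean`, LEAD-NOTES-G4 N11 (5): "the independent-blob caricature"), previously checked on
260 574 instances only; it contains FAR on stars at every layer and the extremal family `o` glued to `j` relays + one gated glued
`(j+1)`-blob (where the inequality is an equality).  The threshold `EX/2` is sharp (two independent arms: `P(X ≤ 1) = 1 − q² > 1 − q`
as soon as `2q·λ > 1`, `λ > 1/2`).

**Proof.**  Condition on the least reliable gate `ε₀`; we must show `p₀·P(X' < m/2 − a₀) + (1 − p₀)·P(X' < m/2) ≤ 1 − p₀`,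
`X' = ∑ a_i ε_i`.  (C) If `p₀ ≥ 1/2`: HALL + HARRIS.  With `λ = m/2 − a₀`, `η = m/2` we have `λ + η = m − a₀ ≤ ∑ a_i`, and then the light
sets `{W : a(W) < λ}` inject into heavy supersets `{V ⊋ W : a(V) ≥ η}` (`exists_injective_heavy_superset`): Hall's condition for the
containment relation reduces, for an up-set `𝒰`, to `#{W ∈ 𝒰 : a(Wᶜ) ≥ η} ≤ #(𝒰 ∩ {a ≥ η})`, which is the ANTIPODAL HARRIS inequality
`AntipodalHarris.card_inter_antipode_le` (Harris–Kleitman twice).  Along `W ↦ φ(W) ⊋ W` the product weight changes by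
`∏_{t ∈ φ W ∖ W} p_t/(1 − p_t) ≥ p₀/(1 − p₀)` (all gates `≥ 1/2`), so `p₀·P(X' < λ) ≤ (1 − p₀)·P(X' ≥ η)` and the claim follows.
(B) If `p₀ < 1/2` and some weight is `≥ m/2`, that gate alone decides; otherwise Cantelli (`…QuantIndepBlobMoments.lean`).
No sorries; standard axioms.  Nearest prior art searched (corpus fts + vec, galaxy): small-ball / anti-concentration bounds for
Bernoulli sums (Paley–Zygmund, Feige 2006, Jogdeo–Samuels 1968 median bounds) — none gives the gate-wise constant `min_i p_i` at the
threshold `EX/2`; recorded as [this work].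
-/

namespace Summit.CriticalPhenomena.PercolationContinuityZ3.Theorems

namespace Quant

namespace IndepBlob

open Finset

variable {ι : Type*} [Fintype ι] [DecidableEq ι]

/-- **Light sets inject into heavy supersets** (Hall + antipodal Harris).  For weights `a_i ≥ 0` and thresholds `λ, η` with
`λ + η ≤ ∑ a_i`, there is an injection `φ` from `{W : a(W) < λ}` into `Finset ι` with `W ⊆ φ W` and `a(φ W) ≥ η`.
Hall's condition for an up-set `𝒰` generated by light sets: every light `W ∈ 𝒰` has `a(Wᶜ) ≥ ∑ a − λ ≥ η`, so
`#(light ∩ 𝒰) ≤ #(𝒰 ∩ antipode{a ≥ η}) ≤ #(𝒰 ∩ {a ≥ η})` by `AntipodalHarris.card_inter_antipode_le`. [this work] -/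
theorem exists_injective_heavy_superset (a : ι → ℝ) (ha : ∀ i, 0 ≤ a i) (lam eta : ℝ)
    (h : lam + eta ≤ ∑ i, a i) :
    ∃ φ : {W : Finset ι // ∑ i ∈ W, a i < lam} → Finset ι,
      Function.Injective φ ∧ ∀ W : {W : Finset ι // ∑ i ∈ W, a i < lam}, (W : Finset ι) ⊆ φ W ∧ eta ≤ ∑ i ∈ φ W, a i := by
  set t : {W : Finset ι // ∑ i ∈ W, a i < lam} → Finset (Finset ι) :=
    fun W => (Finset.univ : Finset (Finset ι)).filter (fun V => (W : Finset ι) ⊆ V ∧ eta ≤ ∑ i ∈ V, a i) with ht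
  suffices hHall : ∀ 𝒮 : Finset {W : Finset ι // ∑ i ∈ W, a i < lam}, 𝒮.card ≤ (𝒮.biUnion t).card by
    obtain ⟨φ, hφinj, hφ⟩ := (Finset.all_card_le_biUnion_card_iff_exists_injective t).1 hHall
    refine ⟨φ, hφinj, fun W => ?_⟩
    have hW := hφ W
    rw [ht, Finset.mem_filter] at hW
    exact hW.2
  intro 𝒮
  set 𝒰 : Finset (Finset ι) := Finset.univ.filter (fun V => ∃ W ∈ 𝒮, (W : Finset ι) ⊆ V) with h𝒰
  set H : Finset (Finset ι) := Finset.univ.filter (fun V => eta ≤ ∑ i ∈ V, a i) with hH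
  have h𝒰up : IsUpperSet (𝒰 : Set (Finset ι)) := by
    intro V V' hVV' hV
    rw [Finset.mem_coe, h𝒰, Finset.mem_filter] at hV ⊢
    obtain ⟨-, W, hW, hWV⟩ := hV
    exact ⟨Finset.mem_univ _, W, hW, hWV.trans hVV'⟩
  have hHup : IsUpperSet (H : Set (Finset ι)) := by
    intro V V' hVV' hV
    rw [Finset.mem_coe, hH, Finset.mem_filter] at hV ⊢
    exact ⟨Finset.mem_univ _, hV.2.trans (Finset.sum_le_sum_of_subset_of_nonneg hVV' fun i _ _ => ha i)⟩
  have hbi : 𝒮.biUnion t = 𝒰 ∩ H := by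
    ext V
    simp only [Finset.mem_biUnion, ht, h𝒰, hH, Finset.mem_filter, Finset.mem_univ, true_and, Finset.mem_inter]
    constructor
    · rintro ⟨W, hW, hWV, hV⟩
      exact ⟨⟨W, hW, hWV⟩, hV⟩
    · rintro ⟨⟨W, hW, hWV⟩, hV⟩
      exact ⟨W, hW, hWV, hV⟩
  have hsub : 𝒮.map (Function.Embedding.subtype _) ⊆ 𝒰 ∩ AntipodalHarris.antipode H := by
    intro V hV
    rw [Finset.mem_map] at hV
    obtain ⟨W, hW, rfl⟩ := hV
    rw [Finset.mem_inter, AntipodalHarris.mem_antipode]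
    refine ⟨?_, ?_⟩
    · rw [h𝒰, Finset.mem_filter]
      exact ⟨Finset.mem_univ _, W, hW, subset_rfl⟩
    · rw [hH, Finset.mem_filter]
      refine ⟨Finset.mem_univ _, ?_⟩
      have hc : ∑ i ∈ ((W : Finset ι))ᶜ, a i = ∑ i, a i - ∑ i ∈ (W : Finset ι), a i := by
        rw [eq_sub_iff_add_eq, Finset.sum_compl_add_sum]
      have hW' : ∑ i ∈ (W : Finset ι), a i < lam := W.2
      show eta ≤ ∑ i ∈ ((W : Finset ι))ᶜ, a i
      rw [hc]
      linarith
  calc 𝒮.card = (𝒮.map (Function.Embedding.subtype _)).card := (Finset.card_map _).symm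
    _ ≤ (𝒰 ∩ AntipodalHarris.antipode H).card := Finset.card_le_card hsub
    _ ≤ (𝒰 ∩ H).card := AntipodalHarris.card_inter_antipode_le h𝒰up hHup
    _ = (𝒮.biUnion t).card := by rw [hbi]

/-- **Weight transport along a strict superset when every gate is at least `p₀ ≥ 1/2`:**
`p₀ · w(W) ≤ (1 − p₀) · w(V)` for `W ⊊ V` — opening the extra gates `V ∖ W` multiplies the weight by
`∏ p_t/(1 − p_t) ≥ p₀/(1 − p₀)`. [this work] -/
theorem weight_transport {p : ι → ℝ} {p₀ : ℝ} (hhalf : 1 / 2 ≤ p₀) (hp : ∀ i, p₀ ≤ p i) (hp1 : ∀ i, p i ≤ 1)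
    {W V : Finset ι} (hWV : W ⊆ V) (hne : W ≠ V) :
    p₀ * (∏ k, if k ∈ W then p k else 1 - p k) ≤ (1 - p₀) * (∏ k, if k ∈ V then p k else 1 - p k) := by
  set T : Finset ι := V \ W with hT
  have hTne : T.Nonempty := by
    rw [hT, Finset.sdiff_nonempty]
    intro hVW
    exact hne (Finset.Subset.antisymm hWV hVW)
  obtain ⟨t₀, ht₀⟩ := hTne
  have ht₀' : t₀ ∈ V ∧ t₀ ∉ W := by rw [hT, Finset.mem_sdiff] at ht₀; exact ht₀
  -- the common factor off `T`
  set gW : ι → ℝ := fun i => if i ∈ W then p i else 1 - p i with hgW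
  set gV : ι → ℝ := fun i => if i ∈ V then p i else 1 - p i with hgV
  have hgW0 : ∀ i, 0 ≤ gW i := fun i => by
    simp only [hgW]
    split_ifs
    · linarith [hp i]
    · linarith [hp1 i]
  have splitW : (∏ k, if k ∈ W then p k else 1 - p k) = (∏ i ∈ T, gW i) * ∏ i ∈ Tᶜ, gW i := by
    rw [Finset.prod_mul_prod_compl]
  have splitV : (∏ k, if k ∈ V then p k else 1 - p k) = (∏ i ∈ T, gV i) * ∏ i ∈ Tᶜ, gV i := by
    rw [Finset.prod_mul_prod_compl]
  have hTW : ∏ i ∈ T, gW i = ∏ i ∈ T, (1 - p i) := by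
    refine Finset.prod_congr rfl fun i hi => ?_
    rw [hT, Finset.mem_sdiff] at hi
    simp [hgW, hi.2]
  have hTV : ∏ i ∈ T, gV i = ∏ i ∈ T, p i := by
    refine Finset.prod_congr rfl fun i hi => ?_
    rw [hT, Finset.mem_sdiff] at hi
    simp [hgV, hi.1]
  have hC : ∏ i ∈ Tᶜ, gV i = ∏ i ∈ Tᶜ, gW i := by
    refine Finset.prod_congr rfl fun i hi => ?_
    rw [Finset.mem_compl, hT, Finset.mem_sdiff, not_and, not_not] at hi
    by_cases hiW : i ∈ W
    · simp [hgV, hgW, hiW, hWV hiW]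
    · have hiV : i ∉ V := fun hiV => hiW (hi hiV)
      simp [hgV, hgW, hiW, hiV]
  have hC0 : 0 ≤ ∏ i ∈ Tᶜ, gW i := Finset.prod_nonneg fun i _ => hgW0 i
  -- the comparison on `T`
  have hcore : p₀ * ∏ i ∈ T, (1 - p i) ≤ (1 - p₀) * ∏ i ∈ T, p i := by
    rw [← Finset.mul_prod_erase T (fun i => 1 - p i) ht₀, ← Finset.mul_prod_erase T p ht₀]
    have h1 : p₀ * (1 - p t₀) ≤ (1 - p₀) * p t₀ := by nlinarith [hp t₀, hp1 t₀]
    have h2 : ∏ i ∈ T.erase t₀, (1 - p i) ≤ ∏ i ∈ T.erase t₀, p i :=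
      Finset.prod_le_prod (fun i _ => by linarith [hp1 i]) fun i _ => by linarith [hp i]
    have h3 : 0 ≤ ∏ i ∈ T.erase t₀, (1 - p i) := Finset.prod_nonneg fun i _ => by linarith [hp1 i]
    have h4 : 0 ≤ (1 - p₀) * p t₀ := mul_nonneg (by linarith [hp t₀, hp1 t₀]) (by linarith [hp t₀])
    calc p₀ * ((1 - p t₀) * ∏ i ∈ T.erase t₀, (1 - p i)) = (p₀ * (1 - p t₀)) * ∏ i ∈ T.erase t₀, (1 - p i) := by ring
      _ ≤ ((1 - p₀) * p t₀) * ∏ i ∈ T.erase t₀, p i := mul_le_mul h1 h2 h3 h4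
      _ = (1 - p₀) * (p t₀ * ∏ i ∈ T.erase t₀, p i) := by ring
  rw [splitW, splitV, hTW, hTV, hC]
  calc p₀ * ((∏ i ∈ T, (1 - p i)) * ∏ i ∈ Tᶜ, gW i) = (p₀ * ∏ i ∈ T, (1 - p i)) * ∏ i ∈ Tᶜ, gW i := by ring
    _ ≤ ((1 - p₀) * ∏ i ∈ T, p i) * ∏ i ∈ Tᶜ, gW i := mul_le_mul_of_nonneg_right hcore hC0
    _ = (1 - p₀) * ((∏ i ∈ T, p i) * ∏ i ∈ Tᶜ, gW i) := by ring

/-- **Hall–Harris half of the half-mean small-ball inequality** (least reliable gate `p₀ ≥ 1/2`, hence all gates `≥ 1/2`):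
`p₀ · P(X + a₀ < m/2) + (1 − p₀) · P(X < m/2) ≤ 1 − p₀`, `m = a₀ p₀ + ∑ a_i p_i`, with NO restriction on the weights.
(In this regime the threshold `m/2` may even be replaced by `(a₀ + ∑ a_i)/2`; we state the half-mean form.) [this work] -/
theorem halfMean_smallBall_of_half_le_gate (p a : ι → ℝ) (p₀ a₀ : ℝ) (hhalf : 1 / 2 ≤ p₀) (hp₀1 : p₀ ≤ 1)
    (hp : ∀ i, p₀ ≤ p i) (hp1 : ∀ i, p i ≤ 1) (ha : ∀ i, 0 ≤ a i) (ha₀ : 0 ≤ a₀) :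
    p₀ * (∑ W ∈ (Finset.univ : Finset (Finset ι)).filter
        (fun W => ∑ i ∈ W, a i + a₀ < (a₀ * p₀ + ∑ i, a i * p i) / 2), (∏ k, if k ∈ W then p k else 1 - p k)) +
      (1 - p₀) * (∑ W ∈ (Finset.univ : Finset (Finset ι)).filter
        (fun W => ∑ i ∈ W, a i < (a₀ * p₀ + ∑ i, a i * p i) / 2), (∏ k, if k ∈ W then p k else 1 - p k)) ≤ 1 - p₀ := by
  set t : ℝ := (a₀ * p₀ + ∑ i, a i * p i) / 2 with ht
  have hp₀ : 0 ≤ p₀ := by linarith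
  have hf0 : 0 ≤ 1 - p₀ := by linarith
  have hw0 : ∀ W, 0 ≤ (∏ k, if k ∈ W then p k else 1 - p k) := bernoulliWeight_nonneg (fun i => hp₀.trans (hp i)) hp1
  -- thresholds for the injection: `λ = t − a₀`, `η = t`, `λ + η = m − a₀ ≤ ∑ a`
  have hle : (t - a₀) + t ≤ ∑ i, a i := by
    have h1 : ∑ i, a i * p i ≤ ∑ i, a i :=
      Finset.sum_le_sum fun i _ => by nlinarith [ha i, hp1 i]
    have h2 : a₀ * p₀ ≤ a₀ := by nlinarith
    rw [ht]; linarith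
  obtain ⟨φ, hφinj, hφ⟩ := exists_injective_heavy_superset a ha (t - a₀) t hle
  -- the light sum, re-indexed by the subtype
  have hLeq : ∑ W ∈ (Finset.univ : Finset (Finset ι)).filter (fun W => ∑ i ∈ W, a i + a₀ < t), (∏ k, if k ∈ W then p k else 1 - p k) =
      ∑ W : {W : Finset ι // ∑ i ∈ W, a i < t - a₀}, (∏ k, if k ∈ (W : Finset ι) then p k else 1 - p k) := by
    refine Finset.sum_subtype _ (fun W => ?_) _
    rw [Finset.mem_filter]
    constructor
    · intro hW; linarith [hW.2]
    · intro hW; exact ⟨Finset.mem_univ _, by linarith⟩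
  -- transport term by term
  have hstep : ∀ W : {W : Finset ι // ∑ i ∈ W, a i < t - a₀},
      p₀ * (∏ k, if k ∈ (W : Finset ι) then p k else 1 - p k) ≤ (1 - p₀) * (∏ k, if k ∈ φ W then p k else 1 - p k) := by
    intro W
    refine weight_transport hhalf hp hp1 (hφ W).1 fun hWφ => ?_
    have h1 : t ≤ ∑ i ∈ φ W, a i := (hφ W).2
    have h2 : ∑ i ∈ (W : Finset ι), a i < t - a₀ := W.2
    rw [← hWφ] at h1
    linarith
  have hsum : p₀ * ∑ W : {W : Finset ι // ∑ i ∈ W, a i < t - a₀}, (∏ k, if k ∈ (W : Finset ι) then p k else 1 - p k) ≤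
      (1 - p₀) * ∑ W : {W : Finset ι // ∑ i ∈ W, a i < t - a₀}, (∏ k, if k ∈ φ W then p k else 1 - p k) := by
    rw [Finset.mul_sum, Finset.mul_sum]
    exact Finset.sum_le_sum fun W _ => hstep W
  -- the image of `φ` lies in the heavy sets
  have himage : ∑ W : {W : Finset ι // ∑ i ∈ W, a i < t - a₀}, (∏ k, if k ∈ φ W then p k else 1 - p k) ≤
      ∑ V ∈ (Finset.univ : Finset (Finset ι)).filter (fun V => ¬ (∑ i ∈ V, a i < t)), (∏ k, if k ∈ V then p k else 1 - p k) := by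
    rw [← Finset.sum_image (f := fun V : Finset ι => ∏ k, if k ∈ V then p k else 1 - p k) (s := Finset.univ) (g := φ) fun x _ y _ hxy => hφinj hxy]
    refine Finset.sum_le_sum_of_subset_of_nonneg (fun V hV => ?_) fun V _ _ => hw0 V
    rw [Finset.mem_image] at hV
    obtain ⟨W, -, rfl⟩ := hV
    rw [Finset.mem_filter]
    exact ⟨Finset.mem_univ _, not_lt.2 (hφ W).2⟩
  have htot : ∑ V ∈ (Finset.univ : Finset (Finset ι)).filter (fun V => ∑ i ∈ V, a i < t), (∏ k, if k ∈ V then p k else 1 - p k) +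
      ∑ V ∈ (Finset.univ : Finset (Finset ι)).filter (fun V => ¬ (∑ i ∈ V, a i < t)), (∏ k, if k ∈ V then p k else 1 - p k) = 1 := by
    rw [Finset.sum_filter_add_sum_filter_not, sum_bernoulliWeight]
  rw [hLeq]
  calc p₀ * ∑ W : {W : Finset ι // ∑ i ∈ W, a i < t - a₀}, (∏ k, if k ∈ (W : Finset ι) then p k else 1 - p k) +
        (1 - p₀) * ∑ W ∈ (Finset.univ : Finset (Finset ι)).filter (fun W => ∑ i ∈ W, a i < t), (∏ k, if k ∈ W then p k else 1 - p k)
      ≤ (1 - p₀) * ∑ V ∈ (Finset.univ : Finset (Finset ι)).filter (fun V => ¬ (∑ i ∈ V, a i < t)), (∏ k, if k ∈ V then p k else 1 - p k) +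
        (1 - p₀) * ∑ W ∈ (Finset.univ : Finset (Finset ι)).filter (fun W => ∑ i ∈ W, a i < t), (∏ k, if k ∈ W then p k else 1 - p k) := by
          have := hsum.trans (mul_le_mul_of_nonneg_left himage hf0)
          linarith
    _ = 1 - p₀ := by rw [← mul_add, add_comm, htot, mul_one]

/-- **The half-mean small-ball inequality (FAR for independent blobs).**  Gates `p₀ ≤ p_i ≤ 1` (`0 ≤ p₀ ≤ 1`), weights
`a₀, a_i ≥ 0`, `m = a₀ p₀ + ∑ a_i p_i` the mean of `X = a₀ ε₀ + ∑ a_i ε_i`; then, conditioning on the least reliable gate `ε₀`,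
`p₀ · P(∑_{i∈W} a_i + a₀ < m/2) + (1 − p₀) · P(∑_{i∈W} a_i < m/2) ≤ 1 − p₀`, i.e. `P(X < EX/2) ≤ max_i P(gate i closed)`.
Cases: all gates `≥ 1/2` (Hall–Harris transport), or some weight `≥ m/2` (that gate decides), or Cantelli. [this work] -/
theorem halfMean_smallBall (p a : ι → ℝ) (p₀ a₀ : ℝ) (hp₀ : 0 ≤ p₀) (hp₀1 : p₀ ≤ 1)
    (hp : ∀ i, p₀ ≤ p i) (hp1 : ∀ i, p i ≤ 1) (ha : ∀ i, 0 ≤ a i) (ha₀ : 0 ≤ a₀) :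
    p₀ * (∑ W ∈ (Finset.univ : Finset (Finset ι)).filter
        (fun W => ∑ i ∈ W, a i + a₀ < (a₀ * p₀ + ∑ i, a i * p i) / 2), (∏ k, if k ∈ W then p k else 1 - p k)) +
      (1 - p₀) * (∑ W ∈ (Finset.univ : Finset (Finset ι)).filter
        (fun W => ∑ i ∈ W, a i < (a₀ * p₀ + ∑ i, a i * p i) / 2), (∏ k, if k ∈ W then p k else 1 - p k)) ≤ 1 - p₀ := by
  by_cases hhalf : 1 / 2 ≤ p₀
  · exact halfMean_smallBall_of_half_le_gate p a p₀ a₀ hhalf hp₀1 hp hp1 ha ha₀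
  have hhalf' : p₀ ≤ 1 / 2 := by linarith
  set t : ℝ := (a₀ * p₀ + ∑ i, a i * p i) / 2 with ht
  set L := (Finset.univ : Finset (Finset ι)).filter (fun W => ∑ i ∈ W, a i + a₀ < t) with hL
  set K := (Finset.univ : Finset (Finset ι)).filter (fun W => ∑ i ∈ W, a i < t) with hK
  have hf0 : 0 ≤ 1 - p₀ := by linarith
  have hw0 : ∀ W, 0 ≤ (∏ k, if k ∈ W then p k else 1 - p k) := bernoulliWeight_nonneg (fun i => hp₀.trans (hp i)) hp1
  have hLK : L ⊆ K := by
    intro W hW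
    rw [hL, Finset.mem_filter] at hW
    rw [hK, Finset.mem_filter]
    exact ⟨hW.1, by linarith [hW.2]⟩
  have hSLK : ∑ W ∈ L, (∏ k, if k ∈ W then p k else 1 - p k) ≤ ∑ W ∈ K, (∏ k, if k ∈ W then p k else 1 - p k) :=
    Finset.sum_le_sum_of_subset_of_nonneg hLK fun W _ _ => hw0 W
  have hSK1 : ∑ W ∈ K, (∏ k, if k ∈ W then p k else 1 - p k) ≤ 1 := by
    exact (Finset.sum_le_sum_of_subset_of_nonneg (Finset.filter_subset _ _) fun W _ _ => hw0 W).trans_eq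
      (sum_bernoulliWeight p)
  by_cases hbig : ∃ i, t ≤ a i
  · -- a single heavy blob decides
    obtain ⟨i, hi⟩ := hbig
    have hKi : K ⊆ (Finset.univ : Finset (Finset ι)).filter (fun W => i ∉ W) := by
      intro W hW
      rw [hK, Finset.mem_filter] at hW
      rw [Finset.mem_filter]
      refine ⟨hW.1, fun hiW => ?_⟩
      have : a i ≤ ∑ k ∈ W, a k := Finset.single_le_sum (fun k _ => ha k) hiW
      linarith [hW.2]
    have hSKi : ∑ W ∈ K, (∏ k, if k ∈ W then p k else 1 - p k) ≤ 1 - p i := by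
      rw [← sum_bernoulliWeight_filter_not_mem p i]
      exact Finset.sum_le_sum_of_subset_of_nonneg hKi fun W _ _ => hw0 W
    have hpi : 1 - p i ≤ 1 - p₀ := by linarith [hp i]
    have h1 : p₀ * ∑ W ∈ L, (∏ k, if k ∈ W then p k else 1 - p k) ≤ p₀ * (1 - p₀) :=
      mul_le_mul_of_nonneg_left (hSLK.trans (hSKi.trans hpi)) hp₀
    have h2 : (1 - p₀) * ∑ W ∈ K, (∏ k, if k ∈ W then p k else 1 - p k) ≤ (1 - p₀) * (1 - p₀) :=
      mul_le_mul_of_nonneg_left (hSKi.trans hpi) hf0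
    calc p₀ * ∑ W ∈ L, (∏ k, if k ∈ W then p k else 1 - p k) + (1 - p₀) * ∑ W ∈ K, (∏ k, if k ∈ W then p k else 1 - p k)
        ≤ p₀ * (1 - p₀) + (1 - p₀) * (1 - p₀) := add_le_add h1 h2
      _ = 1 - p₀ := by ring
  have hA : ∀ i, a i ≤ t := fun i => by
    by_contra hcon
    exact hbig ⟨i, le_of_lt (not_le.1 hcon)⟩
  by_cases hA₀ : t ≤ a₀
  · -- the distinguished blob alone is heavy: the first event is empty
    have hSL : ∑ W ∈ L, (∏ k, if k ∈ W then p k else 1 - p k) = 0 := by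
      refine Finset.sum_eq_zero fun W hW => ?_
      rw [hL, Finset.mem_filter] at hW
      have : 0 ≤ ∑ i ∈ W, a i := Finset.sum_nonneg fun i _ => ha i
      linarith [hW.2]
    rw [hSL, mul_zero, zero_add]
    calc (1 - p₀) * ∑ W ∈ K, (∏ k, if k ∈ W then p k else 1 - p k) ≤ (1 - p₀) * 1 := mul_le_mul_of_nonneg_left hSK1 hf0
      _ = 1 - p₀ := mul_one _
  exact halfMean_smallBall_of_gate_le_half p a p₀ a₀ hp₀ hhalf' hp hp1 ha ha₀ (le_of_lt (not_le.1 hA₀)) hA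

/-- **FAR for independent blobs, layer form.**  With the data of `halfMean_smallBall` and any real `j` with `2j < m`
(`m = a₀ p₀ + ∑ a_i p_i` the expected count): `p₀ · P(∑_{i∈W} a_i + a₀ ≤ j) + (1 − p₀) · P(∑_{i∈W} a_i ≤ j) ≤ 1 − p₀` — the
far-relay row `EN_o > 2j ⟹ P(N_o ≤ j) ≤ max_a P(o ↮ a)` of `Quant.FarRelayRow` for an observer joined by independent gates to
disjoint glued blobs (conditioning on the least reliable gate). [this work] -/
theorem far_indepBlob (p a : ι → ℝ) (p₀ a₀ : ℝ) (hp₀ : 0 ≤ p₀) (hp₀1 : p₀ ≤ 1)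
    (hp : ∀ i, p₀ ≤ p i) (hp1 : ∀ i, p i ≤ 1) (ha : ∀ i, 0 ≤ a i) (ha₀ : 0 ≤ a₀) (j : ℝ)
    (hj : 2 * j < a₀ * p₀ + ∑ i, a i * p i) :
    p₀ * (∑ W ∈ (Finset.univ : Finset (Finset ι)).filter (fun W => ∑ i ∈ W, a i + a₀ ≤ j), (∏ k, if k ∈ W then p k else 1 - p k)) +
      (1 - p₀) * (∑ W ∈ (Finset.univ : Finset (Finset ι)).filter (fun W => ∑ i ∈ W, a i ≤ j), (∏ k, if k ∈ W then p k else 1 - p k)) ≤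
        1 - p₀ := by
  have hmain := halfMean_smallBall p a p₀ a₀ hp₀ hp₀1 hp hp1 ha ha₀
  have hw0 : ∀ W, 0 ≤ (∏ k, if k ∈ W then p k else 1 - p k) := bernoulliWeight_nonneg (fun i => hp₀.trans (hp i)) hp1
  have hf0 : 0 ≤ 1 - p₀ := by linarith
  have h1 : ∑ W ∈ (Finset.univ : Finset (Finset ι)).filter (fun W => ∑ i ∈ W, a i + a₀ ≤ j), (∏ k, if k ∈ W then p k else 1 - p k) ≤
      ∑ W ∈ (Finset.univ : Finset (Finset ι)).filter
        (fun W => ∑ i ∈ W, a i + a₀ < (a₀ * p₀ + ∑ i, a i * p i) / 2), (∏ k, if k ∈ W then p k else 1 - p k) := by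
    refine Finset.sum_le_sum_of_subset_of_nonneg (fun W hW => ?_) fun W _ _ => hw0 W
    rw [Finset.mem_filter] at hW ⊢
    exact ⟨hW.1, by linarith [hW.2]⟩
  have h2 : ∑ W ∈ (Finset.univ : Finset (Finset ι)).filter (fun W => ∑ i ∈ W, a i ≤ j), (∏ k, if k ∈ W then p k else 1 - p k) ≤
      ∑ W ∈ (Finset.univ : Finset (Finset ι)).filter
        (fun W => ∑ i ∈ W, a i < (a₀ * p₀ + ∑ i, a i * p i) / 2), (∏ k, if k ∈ W then p k else 1 - p k) := by
    refine Finset.sum_le_sum_of_subset_of_nonneg (fun W hW => ?_) fun W _ _ => hw0 W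
    rw [Finset.mem_filter] at hW ⊢
    exact ⟨hW.1, by linarith [hW.2]⟩
  have := add_le_add (mul_le_mul_of_nonneg_left h1 hp₀) (mul_le_mul_of_nonneg_left h2 hf0)
  exact this.trans hmain

end IndepBlob

end Quant

end Summit.CriticalPhenomena.PercolationContinuityZ3.Theorems

/-! ### Prior art: the biased Erdős–Ko–Rado theorem (appended 2026-08-21, lead g16, LEAD-NOTES-G16 N32)

The regime (C) of `halfMean_smallBall` / `far_indepBlob` (all gates `≥ 1/2`) is, up to vocabulary, a 1986 theorem.  In terms of the
CLOSED gate-set `C` (biases `q_i = 1 − p_i`), the failure event `{X ≤ j} = {a(C) ≥ ∑ a − j}` is an up-set of subsets of `ι`, and when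
`2j < EX ≤ ∑ a` any two of its members intersect (`smallBall_closedSets_not_disjoint` below: two disjoint deficient closed sets would give
`∑ a ≤ 2j`).  Fishburn, Frankl, Freed, Lagarias and Odlyzko [cite: FishburnEtAl1986, Thm 1] (as quoted in
[cite: SudaTanakaTokushige2017, Thm 1]) prove: for a product measure on `2^[n]` whose biases satisfy `q^(ℓ) ≤ 1/2` for all but the largest
one, every intersecting family has measure at most the largest bias, with equality only for the star.  Applied to the family above this is
exactly `P(X ≤ j) ≤ max_i (1 − p_i)` for gates `≥ 1/2` (indeed for all but one gate `≥ 1/2`), i.e. the far-relay row on stars and block-stars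
in that regime, including the mean-free form `Quant.halfMean_smallBall_of_card`.  What is NOT covered by [FFLO86]: regime (B) (several gates
below `1/2`, where the threshold shape and the mean hypothesis are used — a general intersecting family with several biases above `1/2`
exceeds its largest bias, e.g. the majority of three), and everything with dependence (spiders with multi-relay legs, trees: in edge space
the failure family is not intersecting).  The proof in this file (Hall + antipodal Harris transport) is different from FFLO's combinatorial
proof and from the semidefinite proof of [cite: SudaTanakaTokushige2017, Thm 2]; the `[this work]` tags above should be read as 'this
proof', not 'this statement', in regime (C). -/

namespace Summit.CriticalPhenomena.PercolationContinuityZ3.Theorems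

namespace Quant

namespace IndepBlob

open Finset

variable {ι : Type*} [Fintype ι] [DecidableEq ι]

/-- **The deficient closed gate-sets form an intersecting family** (the Erdős–Ko–Rado dictionary for the far-relay row on
independent blobs): with weights `a_i ≥ 0`, gates `p_i ≤ 1` and `2j < ∑ a_i p_i`, two open sets `W, W'` each of open mass
`≤ j` cannot have disjoint complements — otherwise `W ∪ W' = univ` and `∑ a ≤ 2j < ∑ a p ≤ ∑ a`.  This is the hypothesis under which
[cite: FishburnEtAl1986, Thm 1] bounds the product measure of the family by its largest bias. [this work] -/
theorem smallBall_closedSets_not_disjoint (p a : ι → ℝ) (hp1 : ∀ i, p i ≤ 1) (ha : ∀ i, 0 ≤ a i)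
    (j : ℝ) (hj : 2 * j < ∑ i, a i * p i) (W W' : Finset ι)
    (hW : ∑ i ∈ W, a i ≤ j) (hW' : ∑ i ∈ W', a i ≤ j) : ¬ Disjoint Wᶜ W'ᶜ := by
  intro hdis
  -- disjoint complements: `W ∪ W' = univ`
  have hunion : W ∪ W' = Finset.univ := by
    rw [← compl_inj_iff, Finset.compl_union, Finset.compl_univ]
    exact Finset.disjoint_iff_inter_eq_empty.1 hdis
  -- `∑ a p ≤ ∑ a = ∑_{W ∪ W'} a ≤ ∑_W a + ∑_{W'} a ≤ 2j`
  have h1 : ∑ i, a i * p i ≤ ∑ i, a i :=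
    Finset.sum_le_sum fun i _ => by nlinarith [ha i, hp1 i]
  have h2 : ∑ i, a i ≤ ∑ i ∈ W, a i + ∑ i ∈ W', a i := by
    rw [← hunion, ← Finset.sum_union_inter]
    linarith [Finset.sum_nonneg (fun i (_ : i ∈ W ∩ W') => ha i)]
  linarith

end IndepBlob

end Quant

end Summit.CriticalPhenomena.PercolationContinuityZ3.Theorems
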